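import Mathlib
import Summits.Ventures.PercRepro.PuncturedLYMFibrationNodeFirst
import Summits.Ventures.PercRepro.PuncturedLYMRatio

/-!
# PercRepro — THE NODE LEMMA FOR THE COUNTS OF A FAMILY: THE SECOND FAMILY IS A THEOREM, THE FIRST FAMILY NEEDS THE
CONVEXITY OF THE CHAIN
(p10, gen 38)

The node lemma of PuncturedLYMFibrationNode / PuncturedLYMFibrationNodeFirst speaks about arbitrary level sequences
`r`, `q`.  Here they are the counts of a family `𝒞` of members on the ground set `S` (the other members of a node of
the fibration recursion): `r t = #rowsOf S t 𝒞`, `q t = #punct S (t+1) 𝒞`.  The ratio hypothesis `hq` of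
`second_family` is the ratio lemma (`ratio_hq`), so the SECOND family is a theorem for every family in which no
`(ℓ+1)`-subset contains two members (`second_family_of_family`).  The FIRST family needs, besides the fibre-0 density
condition and the totals, the convexity of the chain of layer ratios of the counts (`first_family_of_family`:
hypotheses `hu`, `hσ` on `uq`, `vq` of the counts) — a statement about `𝒞` alone, NOT proved here (gen 38 data: every
size multiset on ≤ 12 points).  Nothing here asserts (SP).
-/

namespace PercRepro.PuncturedLYM.Split

open Finset NodeArith

variable {α : Type} [DecidableEq α]

/-- The rows of the family `𝒞` on `S` at level `t`, as a rational. -/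
def rFam (S : Finset α) (𝒞 : Finset (Finset α)) (t : ℕ) : ℚ := ((rowsOf S t 𝒞).card : ℚ)

/-- The member columns of the family `𝒞` on `S` at level `t` (the `(t+1)`-subsets containing a member), as a
rational. -/
def qFam (S : Finset α) (𝒞 : Finset (Finset α)) (t : ℕ) : ℚ := ((punct S (t + 1) 𝒞).card : ℚ)

/-- **THE SECOND FAMILY OF THE NODE LEMMA, FOR THE COUNTS OF A FAMILY.** At a node fibrated over a member of size
`1 ≤ m ≤ ℓ` whose other members `𝒞` (on the remaining ground set `S`) have no two members in a common `(ℓ+1)`-subset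
and rows at every layer, the fibres' bases are nonnegative at every layer as soon as the layered adjacent-row condition
and `Hn 1 ≤ θ·Un 1` hold. -/
theorem second_family_of_family {S : Finset α} {𝒞 : Finset (Finset α)} {ℓ m : ℕ} {ρ θ NC : ℚ}
    (hm : 1 ≤ m) (hmℓ : m ≤ ℓ) (hθ : 0 ≤ θ)
    (hone : ∀ Y ⊆ S, Y.card ≤ ℓ + 1 → ∀ C ∈ 𝒞, ∀ C' ∈ 𝒞, C ⊆ Y → C' ⊆ Y → C = C')
    (hr : ∀ c, c < m → 0 < rFam S 𝒞 (ℓ - c))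
    (htot : Hn m ℓ ρ θ (rFam S 𝒞) (qFam S 𝒞) m = NC)
    (histar : NC + Qn m ℓ (qFam S 𝒞) (m - 1) ≤ ρ * Rn m ℓ (rFam S 𝒞) (m - 1))
    (hone1 : Hn m ℓ ρ θ (rFam S 𝒞) (qFam S 𝒞) 1 ≤ θ * Un m ℓ (rFam S 𝒞) 1) :
    ∀ a, 1 ≤ a → a < m → Hn m ℓ ρ θ (rFam S 𝒞) (qFam S 𝒞) a ≤ θ * Un m ℓ (rFam S 𝒞) a := by
  refine second_family hm hmℓ hθ hr (fun c _ => by unfold qFam; positivity) ?_ htot histar hone1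
  intro c c' hcc' hc'
  have := ratio_hq (S := S) (𝒞 := 𝒞) hmℓ hone (fun c hc => by have := hr c hc; unfold rFam at this; exact this)
    c c' hcc' hc'
  unfold qFam rFam
  exact this

/-- **THE FIRST FAMILY OF THE NODE LEMMA, FOR THE COUNTS OF A FAMILY, MODULO THE CONVEXITY OF THE CHAIN.** If the
fibres have free columns, the chain `b ↦ (uq b, vq b)` of the counts' layer ratios is convex (`hu`, `hσ`), the excess
of layer `0` is nonnegative and the totals are nonnegative, then every partial sum `Hn a` is nonnegative. -/
theorem first_family_of_family {S : Finset α} {𝒞 : Finset (Finset α)} {ℓ m : ℕ} {ρ θ NC : ℚ}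
    (hr : ∀ c, c < m → 0 < rFam S 𝒞 (ℓ - c + 1))
    (hu : ∀ c, c + 1 < m → uq ℓ (rFam S 𝒞) (c + 1) < uq ℓ (rFam S 𝒞) c)
    (hσ : ∀ c c', c ≤ c' → c' + 1 < m →
      (vq ℓ (rFam S 𝒞) (qFam S 𝒞) c' - vq ℓ (rFam S 𝒞) (qFam S 𝒞) (c' + 1)) *
          (uq ℓ (rFam S 𝒞) c - uq ℓ (rFam S 𝒞) (c + 1))
        ≤ (vq ℓ (rFam S 𝒞) (qFam S 𝒞) c - vq ℓ (rFam S 𝒞) (qFam S 𝒞) (c + 1)) *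
          (uq ℓ (rFam S 𝒞) c' - uq ℓ (rFam S 𝒞) (c' + 1)))
    (h0 : 0 ≤ en m ℓ ρ θ (rFam S 𝒞) (qFam S 𝒞) 0)
    (htot : Hn m ℓ ρ θ (rFam S 𝒞) (qFam S 𝒞) m = NC) (hNC : 0 ≤ NC) :
    ∀ a, a ≤ m → 0 ≤ Hn m ℓ ρ θ (rFam S 𝒞) (qFam S 𝒞) a :=
  first_family hr hu hσ h0 htot hNC

end PercRepro.PuncturedLYM.Split
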